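import Mathlib
import Summits.MatrixMultiplication.Statement
import Summits.MatrixMultiplication.MatrixMultiplication.Theorems.GraphEquationsCubicLadder

/-!
# Compressed powers: `r` deflation rounds reach order `K` only if `r + K ≥ D − 1` (lens 5, g48, M82)

Helper for `Summit.MatrixMultiplication.MatrixMultiplication.Theses.GraphEquations.MultiplicityReduction`
(stmt-27806), on the COST-FREE tower dial `TowerReach D r K` of M79 (`GraphEquationsKernelTowers`): every
correct degree-`≤ D` system admits, over some base pair, a KERNEL TOWER of height `≤ r` whose deflated generating
set is ideal-initially isolating to order `K`.  M79 bounded the height from below with the honest power systems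
`{f_q^e}` of degree `2e` (`not_towerReach_pow : r + K + 1 ≤ e → ¬ TowerReach (2e) r K`); M81 decided the
degree-`4` height-`1` dial for every order (`not_towerReach_four_one`).

## The specimen (degree `e + 1` instead of `2e`)

Over `n ≥ e = d + 3`, on the chain of positions `B = (0,0), (1,0), …, (e-1,0)` (`f_i := f_{(i,0)}`, `w := c_B − f_B =
ι((ab)_B)`):
* the MAIN test `u = Σ_{m<e} (e-1 choose m) · f_m · c_B^{e-1-m}` (degree `e + 1`);
* the SLAVES `σ_i = f_i + w·f_{i-1}` (`1 ≤ i ≤ e − 1`, degree `4`; linear in the `f`'s over `ℂ[a,b]`);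
* the plain generator `f_q` at every other position.
Modulo the slaves `f_i ≡ (−w)^i f_B`, so `u ≡ f_B·(c_B − w)^{e-1} = f_B^e` (binomial theorem, `cpMain_eq`): the system
is CORRECT of degree `≤ e + 1`, and its test set lies in `N + I(Γ)^e` with `N` the ideal spanned by the slaves and the
plain generators (`cpTest_mem_cpA`).

## The invariant and the certificate

For every field `μ` that is a kernel field of a set containing the slaves and the plain generators, `D_μ` KILLS them
(`D_μ σ_i = ι(μ_i + (ab)_B μ_{i-1}) ∈ I(Γ) ∩ ι(ℂ[a,b]) = 0`, `derivC_cpLin_eq_zero`), hence `D_μ (N + I^{k+1}) ⊆ N + I^k`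
(Leibniz, `derivC_mem_cpA`), and a kernel tower of height `r` over the test set lands in `N + I^{e-r}`
(`towerSet_subset_cpA`).  Over any base pair `y`, along the LINE `F_{(i,0)} = (−(ab)_B(y))^i · s` (`i < e`), all other
`F_q = 0`, every element of `N` vanishes identically and every element of `I^k` to order `s^k` (`cpA_dvd`); the jet
certificate of M81 (`not_idealInitIsolatedSet_of_jetCert`) then forbids ideal-initial isolation of any order `K < e − r`.

## Results

* `not_towerReach_of_add_le : 4 ≤ D → r + K + 2 ≤ D → ¬ TowerReach D r K` — supersedes `not_towerReach_pow`
  (`2e ≥ e + 1`) and contains M78a's `¬ TowerReach 4 1 1`;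
* `not_towerReach_order_one : ¬ TowerReach D (D − 3) 1` — ORDER `1` NEEDS HEIGHT `≥ D − 2` at degree `D ≥ 4`
  (`h₁(D) ≥ D − 2`, matching the conjectured upper bound of NODE-g45 §3c; `h₁(4) = 2` is Theorem B's case);
* `not_towerReach_order_two : ¬ TowerReach D (D − 4) 2`; at degree `6`: `¬ TowerReach 6 2 2 ∧ ¬ TowerReach 6 3 1`
  (the degree-`6` height-`2` question of NODE-g47 §7.2 at the orders `K ≤ 2` that feed `efmDeg_of_kernelFieldClauseDeg`).
Scope: NEC-side calibration of the tower dial; says nothing about `MultiplicityReduction` itself (rung currency 0).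
-/

noncomputable section

namespace Summit.MatrixMultiplication.MatrixMultiplication.Theorems.GraphEquations

open MvPolynomial Matrix Literature.Computability.AlgebraicComplexity Literature.Computability.AlgebraicComplexity.ArithCircuit

variable {n : ℕ}

/-- A derivation `D_μ` killing every element of `S` maps `span S` into itself (Leibniz). -/
theorem derivC_mem_span_of_forall (μ : Fin n × Fin n → MvPolynomial (MatMulVars n) ℂ)
    {S : Set (MvPolynomial (GraphVars n) ℂ)} (hS : ∀ t ∈ S, derivC μ t = 0)
    {x : MvPolynomial (GraphVars n) ℂ} (hx : x ∈ Ideal.span S) : derivC μ x ∈ Ideal.span S := by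
  induction hx using Submodule.span_induction with
  | mem t ht => rw [hS t ht]; exact zero_mem _
  | zero => rw [derivC_zero]; exact zero_mem _
  | add a b _ _ ha hb => rw [derivC_add]; exact add_mem ha hb
  | smul r a ha iha =>
    rw [smul_eq_mul, derivC_mul]
    exact add_mem (Ideal.mul_mem_left _ _ ha) (Ideal.mul_mem_left _ _ iha)

section CompressedPower

variable (d : ℕ) (hd : d + 3 ≤ n)

/-- Chain position `i ↦ (i, 0)` (row index read modulo `n`; only `i < d + 3 ≤ n` is used). -/
def cpPos (i : ℕ) : Fin n × Fin n :=
  have hn : 0 < n := by omega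
  (⟨i % n, Nat.mod_lt _ hn⟩, ⟨0, hn⟩)

/-- In range, `cpPos i` has row `i`. -/
theorem cpPos_fst {i : ℕ} (hi : i < n) : ((cpPos d hd i).1 : ℕ) = i := Nat.mod_eq_of_lt hi

/-- `cpPos i` has column `0`. -/
theorem cpPos_snd (i : ℕ) : ((cpPos d hd i).2 : ℕ) = 0 := rfl

/-- A chain position `q` (column `0`, row `< d + 3`) is `cpPos q.1`. -/
theorem cpPos_eq {q : Fin n × Fin n} (hq : (q.2 : ℕ) = 0 ∧ (q.1 : ℕ) < d + 3) : cpPos d hd q.1 = q :=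
  Prod.ext (Fin.ext (Nat.mod_eq_of_lt q.1.isLt)) (Fin.ext hq.1.symm)

/-- `f_i := f_{(i,0)}`. -/
def cpGen (i : ℕ) : MvPolynomial (GraphVars n) ℂ := generator n (cpPos d hd i)

/-- `w := c_B − f_B = ι((ab)_B)`, `B = (0,0)`. -/
def cpW : MvPolynomial (GraphVars n) ℂ := X (Sum.inr (cpPos d hd 0)) - cpGen d hd 0

/-- `w = ι((ab)_B)`. -/
theorem cpW_eq : cpW d hd = liftAB n (abBase n (cpPos d hd 0)) := by rw [liftAB_abBase]; rfl

/-- The cpSlave `σ_i = f_i + w·f_{i-1}`. -/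
def cpSlave (i : ℕ) : MvPolynomial (GraphVars n) ℂ := cpGen d hd i + cpW d hd * cpGen d hd (i - 1)

/-- The main test `u = Σ_{m < d+3} f_m · c_B^{d+2-m} · (d+2 choose m)`. -/
def cpMain : MvPolynomial (GraphVars n) ℂ :=
  ∑ m ∈ Finset.range (d + 3), cpGen d hd m * X (Sum.inr (cpPos d hd 0)) ^ (d + 2 - m) * C (((d + 2).choose m : ℕ) : ℂ)

/-- The test at position `q`: main test at `B`, cpSlave `σ_i` at `(i,0)` (`1 ≤ i ≤ d+2`), plain generator elsewhere. -/
def cpTest (q : Fin n × Fin n) : MvPolynomial (GraphVars n) ℂ :=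
  if (q.2 : ℕ) = 0 ∧ (q.1 : ℕ) < d + 3 then (if (q.1 : ℕ) = 0 then cpMain d hd else cpSlave d hd q.1) else generator n q

/-- The LINEAR tests: slaves and plain generators. -/
def cpLin : Set (MvPolynomial (GraphVars n) ℂ) :=
  {t | (∃ i, 1 ≤ i ∧ i ≤ d + 2 ∧ t = cpSlave d hd i) ∨ ∃ q : Fin n × Fin n, ¬((q.2 : ℕ) = 0 ∧ (q.1 : ℕ) < d + 3) ∧ t = generator n q}

/-- `N + I(Γ)^k`, `N = span cpLin`. -/
def cpA (k : ℕ) : Ideal (MvPolynomial (GraphVars n) ℂ) := Ideal.span (cpLin d hd) ⊔ graphIdeal n ^ k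

/-- The test at `B = (0,0)` is the main test. -/
theorem cpTest_cpPos_zero : cpTest d hd (cpPos d hd 0) = cpMain d hd := by
  unfold cpTest; rw [if_pos ⟨rfl, by rw [cpPos_fst d hd (by omega)]; omega⟩, if_pos (cpPos_fst d hd (by omega))]

/-- The test at `(i,0)`, `1 ≤ i ≤ d + 2`, is the slave `σ_i`. -/
theorem cpTest_cpPos_of_pos {i : ℕ} (hi1 : 1 ≤ i) (hi2 : i ≤ d + 2) : cpTest d hd (cpPos d hd i) = cpSlave d hd i := by
  unfold cpTest
  rw [if_pos ⟨rfl, by rw [cpPos_fst d hd (by omega)]; omega⟩, cpPos_fst d hd (by omega), if_neg (by omega)]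

/-- The linear tests are tests. -/
theorem cpLin_subset_range : cpLin d hd ⊆ Set.range (cpTest d hd) := by
  rintro t (⟨i, hi1, hi2, rfl⟩ | ⟨q, hq, rfl⟩)
  · exact ⟨cpPos d hd i, cpTest_cpPos_of_pos d hd hi1 hi2⟩
  · exact ⟨q, by unfold cpTest; rw [if_neg hq]⟩

/-! ### The binomial identity and membership in `N + I^{d+3}` -/

/-- `u = f_B^{d+3} + Σ_m (f_m − (−w)^m f_B) · c_B^{d+2-m} · (d+2 choose m)`. -/
theorem cpMain_eq : cpMain d hd = cpGen d hd 0 ^ (d + 3) + ∑ m ∈ Finset.range (d + 3),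
    (cpGen d hd m - (-cpW d hd) ^ m * cpGen d hd 0) * X (Sum.inr (cpPos d hd 0)) ^ (d + 2 - m) * C (((d + 2).choose m : ℕ) : ℂ) := by
  have hb : (-cpW d hd + X (Sum.inr (cpPos d hd 0))) ^ (d + 2) = ∑ m ∈ Finset.range (d + 3),
      (-cpW d hd) ^ m * X (Sum.inr (cpPos d hd 0)) ^ (d + 2 - m) * C (((d + 2).choose m : ℕ) : ℂ) := by
    rw [add_pow]; simp only [map_natCast]
  have hX : -cpW d hd + X (Sum.inr (cpPos d hd 0)) = cpGen d hd 0 := by rw [cpW]; ring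
  rw [hX] at hb
  have hs : ∑ m ∈ Finset.range (d + 3), (-cpW d hd) ^ m * cpGen d hd 0 * X (Sum.inr (cpPos d hd 0)) ^ (d + 2 - m) *
      C (((d + 2).choose m : ℕ) : ℂ) = cpGen d hd 0 * cpGen d hd 0 ^ (d + 2) := by
    rw [hb, Finset.mul_sum]; exact Finset.sum_congr rfl fun m _ => by ring
  simp only [sub_mul, Finset.sum_sub_distrib, cpMain, hs]; ring

/-- `f_m − (−w)^m f_B ∈ N` for `m ≤ d + 2` (induction along the slaves). -/
theorem cpGen_sub_mem_span : ∀ m, m ≤ d + 2 → cpGen d hd m - (-cpW d hd) ^ m * cpGen d hd 0 ∈ Ideal.span (cpLin d hd)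
  | 0, _ => by simp
  | m + 1, hm => by
    have h : cpGen d hd (m + 1) - (-cpW d hd) ^ (m + 1) * cpGen d hd 0 =
        cpSlave d hd (m + 1) - cpW d hd * (cpGen d hd m - (-cpW d hd) ^ m * cpGen d hd 0) := by
      rw [cpSlave, Nat.add_sub_cancel]; ring
    rw [h]
    exact sub_mem (Ideal.subset_span (Or.inl ⟨m + 1, by omega, hm, rfl⟩)) (Ideal.mul_mem_left _ _ (cpGen_sub_mem_span m (by omega)))

/-- Every test lies in `N + I^{d+3}`. -/
theorem cpTest_mem_cpA (q : Fin n × Fin n) : cpTest d hd q ∈ cpA d hd (d + 3) := by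
  unfold cpTest; split_ifs with hq h0
  · rw [cpMain_eq]
    refine Ideal.add_mem _ (Ideal.mem_sup_right (Ideal.pow_mem_pow (generator_mem_graphIdeal _) _))
      (Ideal.mem_sup_left (Ideal.sum_mem _ fun m hm => ?_))
    exact Ideal.mul_mem_right _ _ (Ideal.mul_mem_right _ _ (cpGen_sub_mem_span d hd m (by simpa [Nat.lt_succ_iff] using hm)))
  · exact Ideal.mem_sup_left (Ideal.subset_span (Or.inl ⟨q.1, by omega, by omega, rfl⟩))
  · exact Ideal.mem_sup_left (Ideal.subset_span (Or.inr ⟨q, hq, rfl⟩))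

/-! ### Kernel fields kill the linear tests; towers stay in `N + I^{e-r}` -/

/-- `D_μ` of a linear test that lies in `I(Γ)` is ZERO (it is the lift of a base polynomial). -/
theorem derivC_cpLin_eq_zero (μ : Fin n × Fin n → MvPolynomial (MatMulVars n) ℂ) {t : MvPolynomial (GraphVars n) ℂ}
    (ht : t ∈ cpLin d hd) (hk : derivC μ t ∈ graphIdeal n) : derivC μ t = 0 := by
  obtain ⟨g, hg⟩ : ∃ g, derivC μ t = liftAB n g := by
    rcases ht with ⟨i, -, -, rfl⟩ | ⟨q, -, rfl⟩
    · exact ⟨μ (cpPos d hd i) + abBase n (cpPos d hd 0) * μ (cpPos d hd (i - 1)), by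
        rw [cpSlave, derivC_add, cpGen, cpGen, derivC_generator, cpW_eq, derivC_liftAB_mul, derivC_generator, map_add, map_mul]⟩
    · exact ⟨μ q, derivC_generator μ q⟩
  rw [hg] at hk ⊢
  rw [(liftAB_mem_graphIdeal_iff g).1 hk, map_zero]

/-- `D_μ (N + I^{k+1}) ⊆ N + I^k` once `D_μ` kills the linear tests. -/
theorem derivC_mem_cpA {μ : Fin n × Fin n → MvPolynomial (MatMulVars n) ℂ} (hμ : ∀ t ∈ cpLin d hd, derivC μ t = 0)
    {k : ℕ} {x : MvPolynomial (GraphVars n) ℂ} (hx : x ∈ cpA d hd (k + 1)) : derivC μ x ∈ cpA d hd k := by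
  obtain ⟨g, hg, w, hw, rfl⟩ := Submodule.mem_sup.1 hx
  rw [derivC_add]
  exact Submodule.add_mem_sup (derivC_mem_span_of_forall μ hμ hg) (derivC_mem_pow_of_mem_pow_succ μ _ k hw)

/-- A kernel tower of height `r` over a set `S ⊇ cpLin` with `S ⊆ N + I^{k+r}` lands in `N + I^k`. -/
theorem towerSet_subset_cpA : ∀ (μs : List (Fin n × Fin n → MvPolynomial (MatMulVars n) ℂ)) (k : ℕ)
    {S : Set (MvPolynomial (GraphVars n) ℂ)}, cpLin d hd ⊆ S → IsKernelTower S μs →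
      S ⊆ ((cpA d hd (k + μs.length) : Ideal _) : Set (MvPolynomial (GraphVars n) ℂ)) →
        towerSet S μs ⊆ ((cpA d hd k : Ideal _) : Set (MvPolynomial (GraphVars n) ℂ))
  | [], k, S, _, _, hS => by simpa using hS
  | μ :: μs, k, S, hlin, hT, hS => by
    have hμ : ∀ t ∈ cpLin d hd, derivC μ t = 0 := fun t ht => derivC_cpLin_eq_zero d hd μ ht (hT.1 t (hlin ht))
    have hS' : S ⊆ ((cpA d hd (k + μs.length + 1) : Ideal _) : Set (MvPolynomial (GraphVars n) ℂ)) := by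
      simpa [List.length_cons, add_assoc] using hS
    refine towerSet_subset_cpA μs k (hlin.trans Set.subset_union_left) hT.2 (Set.union_subset (fun s hs => ?_) ?_)
    · exact (sup_le_sup_left (Ideal.pow_le_pow_right (Nat.le_succ _)) _ : cpA d hd (k + μs.length + 1) ≤ _) (hS' hs)
    · rintro _ ⟨s, hs, rfl⟩
      exact derivC_mem_cpA d hd hμ (hS' hs)

/-! ### The line certificate -/

/-- The line `F_{(i,0)} = (−α)^i s` (`i < d + 3`), all other `F_q = 0`. -/
def cpArc (α : ℂ) : Fin n × Fin n → Polynomial ℂ := fun v =>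
  if (v.2 : ℕ) = 0 ∧ (v.1 : ℕ) < d + 3 then Polynomial.C ((-α) ^ (v.1 : ℕ)) * Polynomial.X else 0

/-- The line passes through the origin of the fibre. -/
theorem cpArc_coeff_zero (α : ℂ) (v : Fin n × Fin n) : (cpArc d α v).coeff 0 = 0 := by
  unfold cpArc; split_ifs <;> simp

/-- Along the line over `y` (`α = (ab)_B(y)`), every element of `N + I^k` vanishes to order `s^k`. -/
theorem cpA_dvd (y : MatMulVars n → ℂ) (k : ℕ) {t : MvPolynomial (GraphVars n) ℂ} (ht : t ∈ cpA d hd k) :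
    Polynomial.X ^ k ∣ aeval (cpArc d (eval y (abBase n (cpPos d hd 0)))) (map (eval y) (liftF n t)) := by
  classical
  set α := eval y (abBase n (cpPos d hd 0))
  let Φ : MvPolynomial (GraphVars n) ℂ →+* Polynomial ℂ :=
    ((aeval (cpArc d α)).toRingHom.comp (map (eval y))).comp (liftF n).toRingHom
  have hgen : ∀ q, Φ (generator n q) = cpArc d α q := fun q => by simp [Φ, liftF_generator]
  have hcv : ∀ i, i < d + 3 → Φ (cpGen d hd i) = Polynomial.C ((-α) ^ i) * Polynomial.X := fun i hi => by
    rw [cpGen, hgen]; unfold cpArc; rw [if_pos ⟨rfl, by rw [cpPos_fst d hd (by omega)]; exact hi⟩, cpPos_fst d hd (by omega)]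
  have hcw : Φ (cpW d hd) = Polynomial.C α := by simp [Φ, cpW_eq, liftF_liftAB, Polynomial.algebraMap_eq, α]
  have hle : cpA d hd k ≤ Ideal.comap Φ (Ideal.span {Polynomial.X ^ k}) := by
    refine sup_le (Ideal.span_le.2 fun t ht => Ideal.mem_comap.2 ?_) ?_
    · suffices h0 : Φ t = 0 by rw [h0]; exact zero_mem _
      rcases ht with ⟨i, hi1, hi2, rfl⟩ | ⟨q, hq, rfl⟩
      · obtain ⟨j, rfl⟩ : ∃ j, i = j + 1 := ⟨i - 1, by omega⟩
        rw [cpSlave, map_add, map_mul, hcv _ (by omega), hcw, Nat.add_sub_cancel, hcv _ (by omega), pow_succ]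
        simp only [map_mul, map_pow, map_neg]; ring
      · rw [hgen]; unfold cpArc; rw [if_neg hq]
    · rw [← Ideal.span_singleton_pow]
      refine le_trans ?_ (Ideal.le_comap_pow Φ k)
      refine Ideal.pow_right_mono (show graphIdeal n ≤ _ from Ideal.span_le.2 ?_) k
      rintro _ ⟨q, rfl⟩
      refine Ideal.mem_comap.2 (Ideal.mem_span_singleton.2 ?_)
      rw [hgen]; unfold cpArc; split_ifs
      exacts [dvd_mul_left _ _, dvd_zero _]
  exact Ideal.mem_span_singleton.1 (Ideal.mem_comap.1 (hle ht))

/-- **No kernel tower of height `r` over the compressed power reaches any order `K < d + 3 − r`, over any `y`.** -/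
theorem cp_tower (μs : List (Fin n × Fin n → MvPolynomial (MatMulVars n) ℂ))
    (hT : IsKernelTower (Set.range (cpTest d hd)) μs) {K : ℕ} (hK : K + μs.length < d + 3) (y : MatMulVars n → ℂ) :
    ¬ IdealInitIsolatedSet (towerSet (Set.range (cpTest d hd)) μs) K y := by
  classical
  have hsub : towerSet (Set.range (cpTest d hd)) μs ⊆
      ((cpA d hd (d + 3 - μs.length) : Ideal _) : Set (MvPolynomial (GraphVars n) ℂ)) :=
    towerSet_subset_cpA d hd μs _ (cpLin_subset_range d hd) hT (by
      rintro _ ⟨q, rfl⟩; rw [Nat.sub_add_cancel (by omega)]; exact cpTest_mem_cpA d hd q)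
  refine not_idealInitIsolatedSet_of_jetCert (cpArc d (eval y (abBase n (cpPos d hd 0)))) (cpArc_coeff_zero d _)
    (show K < d + 3 - μs.length by omega) (fun t ht => cpA_dvd d hd y _ (hsub ht)) fun h => ?_
  have h1 := congr_fun h (cpPos d hd 0)
  simp only [cpArc, cpPos_fst d hd (show 0 < n by omega), Pi.zero_apply] at h1
  rw [if_pos ⟨rfl, by omega⟩] at h1
  simp at h1

/-! ### Correctness, degree, realisation -/

/-- **Correctness**: the tests vanish at `x` iff `x ∈ W_n`. -/
theorem cpTest_zero_iff (x : GraphVars n → ℂ) : (∀ q, eval x (cpTest d hd q) = 0) ↔ x ∈ mmGraph n := by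
  refine ⟨fun h => (mem_mmGraph_iff_eval_generator x).2 fun q => ?_, fun hx q => ?_⟩
  · have hz : ∀ m, m ≤ d + 2 → eval x (cpGen d hd m) = (-eval x (cpW d hd)) ^ m * eval x (cpGen d hd 0) := by
      intro m; induction m with
      | zero => intro; rw [pow_zero, one_mul]
      | succ m ih =>
        intro hm
        have e := h (cpPos d hd (m + 1))
        rw [cpTest_cpPos_of_pos d hd (by omega) hm, cpSlave, Nat.add_sub_cancel, map_add, map_mul] at e
        rw [ih (by omega)] at e; rw [pow_succ]; linear_combination e
    have h0 : eval x (cpGen d hd 0) = 0 := by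
      have e := h (cpPos d hd 0)
      rw [cpTest_cpPos_zero, cpMain_eq, map_add, map_pow, map_sum, Finset.sum_eq_zero fun m hm => ?_, add_zero] at e
      · exact pow_eq_zero_iff (by omega) |>.1 e
      · rw [map_mul, map_mul, map_sub, map_mul, map_pow, map_neg, hz m (by simpa [Nat.lt_succ_iff] using hm), sub_self,
          zero_mul, zero_mul]
    by_cases hq : (q.2 : ℕ) = 0 ∧ (q.1 : ℕ) < d + 3
    · have := hz q.1 (by omega); rw [h0, mul_zero, cpGen, cpPos_eq d hd hq] at this; exact this
    · have := h q; unfold cpTest at this; rwa [if_neg hq] at this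
  · have hg : ∀ q, eval x (generator n q) = 0 := (mem_mmGraph_iff_eval_generator x).1 hx
    unfold cpTest; split_ifs
    · simp [cpMain, cpGen, hg]
    · simp [cpSlave, cpGen, hg]
    · exact hg q

/-- **Degree**: every test has degree `≤ d + 4`. -/
theorem totalDegree_cpTest_le (q : Fin n × Fin n) : (cpTest d hd q).totalDegree ≤ d + 4 := by
  have hcv : ∀ i, (cpGen d hd i).totalDegree ≤ 2 := fun i => totalDegree_generator_le_two n _
  have hcw : (cpW d hd).totalDegree ≤ 2 :=
    (totalDegree_sub _ _).trans (max_le ((totalDegree_X (R := ℂ) _).le.trans one_le_two) (hcv 0))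
  unfold cpTest; split_ifs
  · refine (totalDegree_finsetSum _ _).trans (Finset.sup_le fun m _ => ?_)
    refine (totalDegree_mul _ _).trans ?_
    rw [totalDegree_C, add_zero]
    have hX : (X (Sum.inr (cpPos d hd 0)) ^ (d + 2 - m) : MvPolynomial (GraphVars n) ℂ).totalDegree ≤ d + 2 - m :=
      (totalDegree_pow _ _).trans (by rw [totalDegree_X, mul_one])
    have := hcv m
    exact (totalDegree_mul _ _).trans (by omega)
  · exact (totalDegree_add _ _).trans (max_le ((hcv _).trans (by omega))
      (((totalDegree_mul _ _).trans (Nat.add_le_add hcw (hcv _))).trans (by omega)))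
  · exact (totalDegree_generator_le_two n q).trans (by omega)

include hd in
/-- **The compressed power as a realised system** over `n ≥ d + 3`: correct, degree `≤ d + 4`, and no kernel tower of
height `r` over its test set is ideal-initially isolating to an order `K` with `K + r < d + 3`, over any base pair. -/
theorem exists_cpSystem : ∃ E : EqSystem n, E.Correct ∧ E.IsDegLe (d + 4) ∧
    ∀ μs : List (Fin n × Fin n → MvPolynomial (MatMulVars n) ℂ), IsKernelTower E.testSet μs →
      ∀ K, K + μs.length < d + 3 → ∀ y, ¬ IdealInitIsolatedSet (towerSet E.testSet μs) K y := by
  classical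
  obtain ⟨E, hfan, hto', hfrom'⟩ := exists_realisation_list ((Finset.univ : Finset (Fin n × Fin n)).toList.map (cpTest d hd))
  have hto : ∀ o ∈ E.tests, ∃ q, E.testPoly o = cpTest d hd q := fun o ho =>
    let ⟨q, _, hq⟩ := List.mem_map.1 (hto' o ho); ⟨q, hq.symm⟩
  have hS : E.testSet = Set.range (cpTest d hd) := Set.ext fun t => ⟨fun ht => by
    obtain ⟨o, ho, rfl⟩ := (E.mem_testSet_iff t).1 ht; obtain ⟨q, hq⟩ := hto o ho; exact ⟨q, hq.symm⟩, by
    rintro ⟨q, rfl⟩; exact (E.mem_testSet_iff _).2 (hfrom' _ (List.mem_map_of_mem (Finset.mem_toList.2 (Finset.mem_univ q))))⟩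
  refine ⟨E, ⟨hfan, Set.ext fun x => ⟨fun hx => ?_, fun hx o ho => ?_⟩⟩, fun o => ?_, fun μs hT K hK y => ?_⟩
  · exact (cpTest_zero_iff d hd x).1 fun q => by
      obtain ⟨o, ho, hq⟩ := (E.mem_testSet_iff _).1 (hS.ge (Set.mem_range_self q)); rw [← hq]; exact hx o ho
  · obtain ⟨q, hq⟩ := hto o ho; rw [hq]; exact (cpTest_zero_iff d hd x).2 hx q
  · obtain ⟨q, hq⟩ := hto _ (List.get_mem _ o); rw [hq]; exact totalDegree_cpTest_le d hd q
  · rw [hS] at hT ⊢; exact cp_tower d hd μs hT hK y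

end CompressedPower

/-- **`r` ROUNDS REACH ORDER `K` ONLY IF `r + K ≥ D − 1`**: for `D ≥ 4` and `r + K + 2 ≤ D`, `¬ TowerReach D r K`
(the compressed power with `e = D − 1` over `n = D − 1`).  Supersedes `not_towerReach_pow` (degree `2e`). -/
theorem not_towerReach_of_add_le {D r K : ℕ} (hD : 4 ≤ D) (hrK : r + K + 2 ≤ D) : ¬ TowerReach D r K := by
  intro h
  obtain ⟨E, hE, hdeg, htow⟩ := exists_cpSystem (n := D - 1) (D - 4) (by omega)
  rw [show D - 4 + 4 = D by omega] at hdeg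
  obtain ⟨μs, hlen, hT, y, hy⟩ := h (D - 1) (by omega) E hE hdeg
  exact htow μs hT K (by omega) y hy

/-- **`h₁(D) ≥ D − 2`**: at degree `D ≥ 4`, no kernel tower of height `≤ D − 3` reaches order `1`. -/
theorem not_towerReach_order_one {D : ℕ} (hD : 4 ≤ D) : ¬ TowerReach D (D - 3) 1 :=
  not_towerReach_of_add_le hD (by omega)

/-- Order `2` needs height `≥ D − 3`: no kernel tower of height `≤ D − 4` reaches order `2` at degree `D ≥ 4`. -/
theorem not_towerReach_order_two {D : ℕ} (hD : 4 ≤ D) : ¬ TowerReach D (D - 4) 2 :=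
  not_towerReach_of_add_le hD (by omega)

/-- Degree `6`, the height-`2` question of NODE-g47 §7.2 at the orders that pay: two rounds do not reach order `2`,
three rounds do not reach order `1` (and at degree `5` two rounds do not reach order `1`). -/
theorem not_towerReach_six_two_two : ¬ TowerReach 6 2 2 ∧ ¬ TowerReach 6 3 1 ∧ ¬ TowerReach 5 2 1 :=
  ⟨not_towerReach_of_add_le (by norm_num) le_rfl, not_towerReach_of_add_le (by norm_num) le_rfl,
    not_towerReach_of_add_le (by norm_num) le_rfl⟩

end Summit.MatrixMultiplication.MatrixMultiplication.Theorems.GraphEquations
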